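import Summits.QuantumFields.YangMills.Theorems.BalabanUVNodesN15KingModelGraphReplacementEngine

/-!
# BalabanUVNodes ∕ N15 — THE KING-MODEL RUNG (PART Α-a): THE EXPONENTIAL TREE DECAY OF PROPOSITION 3.6 (3.56) — THE WEIGHTED ENGINE: decay weights are
# extra lines ∕ one-vertex factors of the SAME graph whose coarse and fine versions agree exactly through the pairing, so part Η-a's replacement engine run on
# the DOUBLED graph IS the engine with a weight bound extracted
# (Track A, DAG node N15 = NE2; FAN-OUT v1.1 §N15 s3 «KING-MODEL RUNG … NE2's analogue DECIDED in the model»)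

HONEST FRAMING.  Count-neutral (cell `pub-ymgap`, seat `pub-ymgap-dag-n15-e` g29; `--supports stmt-QuantumFields-27366 --as helper` = K3⁸
`SpineGivenEndpointR13SepCoPHV`).  TEMPLATE LITERATURE: C. King, *The U(1) Higgs model. I. The continuum limit*, Commun. Math. Phys. **102** (1986) 649–677
[King1986], Proposition 3.6 (3.56) p. 662 and its proof p. 664.  Parts Η∕Ι∕Γ∕Δ typed (3.56) at `A = 0` as a bound on `|E^{(k)}(H) − E^{(k+n)}(H)|` by the
rate `L^{−γk}` times the size letters — WITHOUT the exponential tree decay between the external points that the right-hand side of (3.56) displays (part Γ-a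
HONEST SCOPE (c)).  THIS FILE is the generic mechanism that puts the decay back: finite sorts, an `RCLike` field, part Η-a's flat spelling
`graphValLS w src tgt G vtx u`; parts Α-b (the tree length), Α-c–Α-f (King's `A = 0` objects by name) use it.  NOT Bałaban's non-abelian `G(U)` of [B9]; NOT a
node discharge; nothing continuum ∕ ℝ⁴ ∕ OS ∕ mass-gap ∕ Clay.  0 `sorry`; standard axioms.  Text layer of pp. 660–664
(`paper:king1986-cmp102-king-u1-higgs-i` p0012–p0016) re-read by this seat 2026-08-29.

THE PRINT.  p. 662 [PDF 14], Proposition 3.6 (3.56): the right-hand side carries *«exp[−δ d(…, {y_i}, {z_q}, {w_l})]»* with (p. 660 [PDF 12]) *«We define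
dist({u_i}) to be the length of the shortest tree graph connecting {u_i}»*; p. 664 [PDF 16], verbatim: *«We get an upper bound for this expression by replacing
every propagator by the bounds given in Proposition 3.7 and Theorem 3.3, and bounding vertex functions appropriately (the sources, g, h are bounded by C). By
extracting a small part of each propagator, we get the exponential decay on the right-hand side of (3.56).»*

READING (declared; ours).  «Extracting a small part of each propagator»: every line factor is bounded by a STRIPPED majorant times a WEIGHT,
`‖G_ℓ(x, y)‖ ≤ P_ℓ(x, y)·θ_ℓ(x, y)` (King: `θ_ℓ = exp[−δ|x − y|]`, the small part; `P_ℓ` = Prop. 3.7's profile with `δ₀` lowered), and likewise every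
one-vertex factor `‖u_υ(x)‖ ≤ p_υ(x)·ϑ_υ(x)` (an external line to a fixed point `y_υ`: `ϑ_υ = exp[−δ|x − y_υ|]`).  If the product of the weights is at most
`Θ₀` at EVERY placement of the vertices (part Α-b: `Θ₀ = exp[−δ·(tree length of the external points)]` for a connected graph), then `Θ₀` comes out of every
majorant graph value.  For the η-DIFFERENCE `E′ − E` the weights must be read at the SAME (coarse) points on both lattices — `θ_ℓ(pt x′, pt y′)` for the fine
graph — and then the device is: the weights are EXTRA LINES `Λ ⊕ Λ` and EXTRA ONE-VERTEX FACTORS `Υ ⊕ Υ` of the same graph (kernels `G_ℓ∕θ_ℓ` and `θ_ℓ`), the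
extra ones with two-spacing rate ZERO, so part Η-a's engine `norm_graphValLS_sub_le` applied to the doubled graph gives the weighted engine with no new
telescoping.

WHAT THIS FILE PROVES (namespace `Summit.QuantumFields.YangMills.BalabanUVNodes.N15KingModelRung.Graph`).
* §1 DOUBLING LETTERS: `graphValLS_sumElim` (the graph value on lines `Λ ⊕ Λ′`, factors `Υ ⊕ Υ′` splits its products), `graphValLS_eq_zero_of_line` ∕
  `graphValLS_eq_zero_of_factor` (a zero kernel kills the value), ★ `graphValLS_sumElim_le_of_weight` (THE EXTRACTION: nonnegative majorants doubled by weights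
  whose product is `≤ Θ₀` at every placement ⇒ `𝔼(X ⊕ θ; x ⊕ ϑ) ≤ Θ₀·𝔼(X; x)`).
* §2 ★ `abs_graphValLS_le_of_weight` — THE SIZE HALF WITH THE DECAY EXTRACTED (one lattice, real kernels): `|G_ℓ| ≤ P_ℓ·θ_ℓ`, `|u_υ| ≤ p_υ·ϑ_υ`, `Π θ·Π ϑ ≤ Θ₀`
  ⇒ `|E(H)| ≤ Θ₀·𝔼(P; p)`.
* §3 ★★★ **`norm_graphValLS_sub_le_of_weight`** — PART Η-a's ENGINE WITH THE DECAY EXTRACTED: coarse∕fine kernels and one-vertex factors with stripped sizes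
  `P_ℓ`, `p_υ` valid on both lattices (the fine one read through the pairing `pt`, weights INCLUDED read through `pt`), stripped rates `Q_ℓ`, `q_υ`, positive weights
  `θ_ℓ`, `ϑ_υ` with `Π_ℓ θ_ℓ(σ(src ℓ), σ(tgt ℓ))·Π_υ ϑ_υ(σ(vtx υ)) ≤ Θ₀` for every coarse placement `σ`: THEN
  `‖E′ − E‖ ≤ Θ₀·(Σ_ℓ 𝔼(P[ℓ ↦ Q_ℓ]; p) + Σ_υ 𝔼(P; p[υ ↦ q_υ]))` — part Η-a's conclusion VERBATIM times `Θ₀`.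

HONEST SCOPE.  (a) Generic finite sorts; the weights, the tree length and King's objects enter in parts Α-b–Α-f.  (b) The fine graph's weights are read at the
paired coarse points (`θ_ℓ(pt x′, pt y′)`), which is how Prop. 3.9 (3.73) reads its decay; the cost of reading a fine propagator's own decay through the pairing
is part Α-c's.  (c) Nothing about which graphs occur, degrees, §3.5.  Locators: [King1986] Prop. 3.6 (3.56) p.662, p.660 (tree length), p.664 («By extracting a
small part of each propagator …»), pp.664–665 (the replacement step).
-/

noncomputable section
namespace Summit.QuantumFields.YangMills.BalabanUVNodes.N15KingModelRung.Graph

open scoped BigOperators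
open Finset

variable {𝕜 : Type*} [RCLike 𝕜]

/-! ## §1 Doubling letters: the graph on lines `Λ ⊕ Λ′` and factors `Υ ⊕ Υ′`; a zero kernel; the extraction of a weight bound -/

section Doubling
variable {V T Λ Λ' Υ Υ' : Type*} [Fintype V] [DecidableEq V] [Fintype T] [Fintype Λ] [Fintype Λ'] [Fintype Υ] [Fintype Υ']

/-- **THE DOUBLED GRAPH SPLITS**: the value of the graph whose lines are `Λ ⊕ Λ′` (kernels `G ⊕ G′`) and whose one-vertex factors are `Υ ⊕ Υ′` is the vertex
sum of the four products. [folklore] -/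
theorem graphValLS_sumElim {𝕂 : Type*} [CommSemiring 𝕂] (w : 𝕂) (src tgt : Λ → V) (src' tgt' : Λ' → V) (G : Λ → T → T → 𝕂)
    (G' : Λ' → T → T → 𝕂) (vtx : Υ → V) (vtx' : Υ' → V) (u : Υ → T → 𝕂) (u' : Υ' → T → 𝕂) :
    graphValLS w (Sum.elim src src') (Sum.elim tgt tgt') (Sum.elim G G') (Sum.elim vtx vtx') (Sum.elim u u')
      = ∑ σ : V → T, w ^ Fintype.card V *
          (((∏ ℓ, G ℓ (σ (src ℓ)) (σ (tgt ℓ))) * ∏ ℓ', G' ℓ' (σ (src' ℓ')) (σ (tgt' ℓ')))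
            * ((∏ υ, u υ (σ (vtx υ))) * ∏ υ', u' υ' (σ (vtx' υ')))) := by
  unfold graphValLS
  refine sum_congr rfl fun σ _ => ?_
  rw [Fintype.prod_sum_type, Fintype.prod_sum_type]
  simp only [Sum.elim_inl, Sum.elim_inr]

/-- a line carrying the ZERO kernel kills the (majorant) graph value. [folklore] -/
theorem graphValLS_eq_zero_of_line {𝕂 : Type*} [CommSemiring 𝕂] (w : 𝕂) (src tgt : Λ → V) (G : Λ → T → T → 𝕂) (vtx : Υ → V)
    (u : Υ → T → 𝕂) (ℓ₀ : Λ) (h : ∀ x y, G ℓ₀ x y = 0) : graphValLS w src tgt G vtx u = 0 := by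
  unfold graphValLS
  refine sum_eq_zero fun σ _ => ?_
  rw [prod_eq_zero (mem_univ ℓ₀) (h _ _), zero_mul, mul_zero]

/-- a one-vertex factor carrying ZERO kills the (majorant) graph value. [folklore] -/
theorem graphValLS_eq_zero_of_factor {𝕂 : Type*} [CommSemiring 𝕂] (w : 𝕂) (src tgt : Λ → V) (G : Λ → T → T → 𝕂) (vtx : Υ → V)
    (u : Υ → T → 𝕂) (υ₀ : Υ) (h : ∀ x, u υ₀ x = 0) : graphValLS w src tgt G vtx u = 0 := by
  unfold graphValLS
  refine sum_eq_zero fun σ _ => ?_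
  rw [prod_eq_zero (mem_univ υ₀) (h _), mul_zero, mul_zero]

/-- ★ **THE EXTRACTION OF A WEIGHT BOUND** — «by extracting a small part of each propagator, we get the exponential decay»: a majorant graph on nonnegative
data `X`, `x` DOUBLED by weight lines `θ_ℓ` (same endpoints) and weight factors `ϑ_υ` (same vertices) whose product is at most `Θ₀` at EVERY placement is at
most `Θ₀` times the undoubled majorant graph. [cite: King1986, p.664 («By extracting a small part of each propagator, we get the exponential decay on the
right-hand side of (3.56)»)] -/
theorem graphValLS_sumElim_le_of_weight {ω : ℝ} (hω : 0 ≤ ω) (src tgt : Λ → V) (vtx : Υ → V) (X θ : Λ → T → T → ℝ) (x ϑ : Υ → T → ℝ)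
    (hX : ∀ ℓ a b, 0 ≤ X ℓ a b) (hx : ∀ υ a, 0 ≤ x υ a) {Θ₀ : ℝ}
    (hΘ : ∀ σ : V → T, (∏ ℓ, θ ℓ (σ (src ℓ)) (σ (tgt ℓ))) * ∏ υ, ϑ υ (σ (vtx υ)) ≤ Θ₀) :
    graphValLS ω (Sum.elim src src) (Sum.elim tgt tgt) (Sum.elim X θ) (Sum.elim vtx vtx) (Sum.elim x ϑ) ≤ Θ₀ * graphValLS ω src tgt X vtx x := by
  rw [graphValLS_sumElim]
  unfold graphValLS
  rw [mul_sum]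
  refine sum_le_sum fun σ _ => ?_
  have h0 : 0 ≤ ω ^ Fintype.card V * ((∏ ℓ, X ℓ (σ (src ℓ)) (σ (tgt ℓ))) * ∏ υ, x υ (σ (vtx υ))) :=
    mul_nonneg (pow_nonneg hω _) (mul_nonneg (prod_nonneg fun ℓ _ => hX _ _ _) (prod_nonneg fun υ _ => hx _ _))
  calc ω ^ Fintype.card V * (((∏ ℓ, X ℓ (σ (src ℓ)) (σ (tgt ℓ))) * ∏ ℓ, θ ℓ (σ (src ℓ)) (σ (tgt ℓ)))
          * ((∏ υ, x υ (σ (vtx υ))) * ∏ υ, ϑ υ (σ (vtx υ))))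
        = ((∏ ℓ, θ ℓ (σ (src ℓ)) (σ (tgt ℓ))) * ∏ υ, ϑ υ (σ (vtx υ)))
            * (ω ^ Fintype.card V * ((∏ ℓ, X ℓ (σ (src ℓ)) (σ (tgt ℓ))) * ∏ υ, x υ (σ (vtx υ)))) := by ring
    _ ≤ Θ₀ * (ω ^ Fintype.card V * ((∏ ℓ, X ℓ (σ (src ℓ)) (σ (tgt ℓ))) * ∏ υ, x υ (σ (vtx υ)))) :=
        mul_le_mul_of_nonneg_right (hΘ σ) h0

end Doubling

/-! ## §2 The size half with the decay extracted (one lattice) -/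

section Size
variable {V T Λ Υ : Type*} [Fintype V] [DecidableEq V] [Fintype T] [Fintype Λ] [Fintype Υ]

/-- ★ **THE SIZE OF A GRAPH WITH THE DECAY EXTRACTED**: real kernels and one-vertex factors bounded by STRIPPED nonnegative majorants times weights,
`|G_ℓ(a, b)| ≤ P_ℓ(a, b)·θ_ℓ(a, b)`, `|u_υ(a)| ≤ p_υ(a)·ϑ_υ(a)`, the weights' product at most `Θ₀` at every placement: `|E(H)| ≤ Θ₀·𝔼(P; p)` — p. 664 «replacing
every propagator by the bounds … By extracting a small part of each propagator, we get the exponential decay». [cite: King1986, p.664 (proof of Prop. 3.6)] -/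
theorem abs_graphValLS_le_of_weight (w : ℝ) (src tgt : Λ → V) (vtx : Υ → V) (G P θ : Λ → T → T → ℝ) (u p ϑ : Υ → T → ℝ)
    (hP0 : ∀ ℓ a b, 0 ≤ P ℓ a b) (hθ0 : ∀ ℓ a b, 0 ≤ θ ℓ a b) (hp0 : ∀ υ a, 0 ≤ p υ a) (hϑ0 : ∀ υ a, 0 ≤ ϑ υ a)
    (hP : ∀ ℓ a b, |G ℓ a b| ≤ P ℓ a b * θ ℓ a b) (hp : ∀ υ a, |u υ a| ≤ p υ a * ϑ υ a) {Θ₀ : ℝ}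
    (hΘ : ∀ σ : V → T, (∏ ℓ, θ ℓ (σ (src ℓ)) (σ (tgt ℓ))) * ∏ υ, ϑ υ (σ (vtx υ)) ≤ Θ₀) :
    |graphValLS w src tgt G vtx u| ≤ Θ₀ * graphValLS |w| src tgt P vtx p := by
  unfold graphValLS
  rw [mul_sum]
  refine (abs_sum_le_sum_abs _ _).trans (sum_le_sum fun σ _ => ?_)
  rw [abs_mul, abs_pow, abs_mul, abs_prod, abs_prod]
  have h1 : ∏ ℓ, |G ℓ (σ (src ℓ)) (σ (tgt ℓ))| ≤ (∏ ℓ, P ℓ (σ (src ℓ)) (σ (tgt ℓ))) * ∏ ℓ, θ ℓ (σ (src ℓ)) (σ (tgt ℓ)) := by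
    rw [← prod_mul_distrib]; exact prod_le_prod (fun ℓ _ => abs_nonneg _) fun ℓ _ => hP _ _ _
  have h2 : ∏ υ, |u υ (σ (vtx υ))| ≤ (∏ υ, p υ (σ (vtx υ))) * ∏ υ, ϑ υ (σ (vtx υ)) := by
    rw [← prod_mul_distrib]; exact prod_le_prod (fun υ _ => abs_nonneg _) fun υ _ => hp _ _
  have hPn : 0 ≤ ∏ ℓ, P ℓ (σ (src ℓ)) (σ (tgt ℓ)) := prod_nonneg fun ℓ _ => hP0 _ _ _
  have hpn : 0 ≤ ∏ υ, p υ (σ (vtx υ)) := prod_nonneg fun υ _ => hp0 _ _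
  have hθn : 0 ≤ ∏ ℓ, θ ℓ (σ (src ℓ)) (σ (tgt ℓ)) := prod_nonneg fun ℓ _ => hθ0 _ _ _
  have hϑn : 0 ≤ ∏ υ, ϑ υ (σ (vtx υ)) := prod_nonneg fun υ _ => hϑ0 _ _
  have hw0 : 0 ≤ |w| ^ Fintype.card V := pow_nonneg (abs_nonneg _) _
  calc |w| ^ Fintype.card V * ((∏ ℓ, |G ℓ (σ (src ℓ)) (σ (tgt ℓ))|) * ∏ υ, |u υ (σ (vtx υ))|)
      ≤ |w| ^ Fintype.card V * (((∏ ℓ, P ℓ (σ (src ℓ)) (σ (tgt ℓ))) * ∏ ℓ, θ ℓ (σ (src ℓ)) (σ (tgt ℓ)))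
          * ((∏ υ, p υ (σ (vtx υ))) * ∏ υ, ϑ υ (σ (vtx υ)))) :=
        mul_le_mul_of_nonneg_left (mul_le_mul h1 h2 (prod_nonneg fun υ _ => abs_nonneg _) (mul_nonneg hPn hθn)) hw0
    _ = ((∏ ℓ, θ ℓ (σ (src ℓ)) (σ (tgt ℓ))) * ∏ υ, ϑ υ (σ (vtx υ)))
          * (|w| ^ Fintype.card V * ((∏ ℓ, P ℓ (σ (src ℓ)) (σ (tgt ℓ))) * ∏ υ, p υ (σ (vtx υ)))) := by ring
    _ ≤ Θ₀ * (|w| ^ Fintype.card V * ((∏ ℓ, P ℓ (σ (src ℓ)) (σ (tgt ℓ))) * ∏ υ, p υ (σ (vtx υ)))) :=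
        mul_le_mul_of_nonneg_right (hΘ σ) (mul_nonneg hw0 (mul_nonneg hPn hpn))

end Size

/-! ## §3 The replacement engine with the decay extracted (two lattices, weights read at the paired coarse points) -/

section Engine
variable {V S S' Λ Υ : Type*} [Fintype V] [DecidableEq V] [Fintype S] [DecidableEq S] [Fintype S'] [Fintype Λ] [Fintype Υ]
  [DecidableEq Λ] [DecidableEq Υ]

omit [Fintype V] [DecidableEq V] [Fintype S] [DecidableEq S] [Fintype S'] [Fintype Λ] [Fintype Υ] [DecidableEq Λ] [DecidableEq Υ] in
/-- stripping a factor by a positive weight: `‖z‖ ≤ P·θ`, `0 < θ` ⇒ `‖(θ : 𝕜)⁻¹·z‖ ≤ P`. [folklore] -/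
theorem norm_inv_ofReal_mul_le {z : 𝕜} {P θ : ℝ} (hθ : 0 < θ) (h : ‖z‖ ≤ P * θ) : ‖((θ : 𝕜))⁻¹ * z‖ ≤ P := by
  rw [norm_mul, norm_inv, RCLike.norm_ofReal, abs_of_pos hθ]
  rw [inv_mul_le_iff₀ hθ, mul_comm]
  exact h

omit [Fintype V] [DecidableEq V] [Fintype S] [DecidableEq S] [Fintype S'] [Fintype Λ] [Fintype Υ] [DecidableEq Λ] [DecidableEq Υ] in
/-- un-stripping: `(θ : 𝕜)·((θ : 𝕜)⁻¹·z) = z` for `θ ≠ 0`. [folklore] -/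
theorem ofReal_mul_inv_mul {z : 𝕜} {θ : ℝ} (hθ : θ ≠ 0) : ((θ : 𝕜))⁻¹ * z * (θ : 𝕜) = z := by
  rw [mul_comm, mul_inv_cancel_left₀ ((RCLike.ofReal_ne_zero).2 hθ)]

/-- ★★★ **KING's REPLACEMENT STEP WITH «A SMALL PART OF EACH PROPAGATOR» EXTRACTED (the weighted engine).**  Two graphs of the same shape: coarse kernels `G_ℓ`
on `S` and one-vertex factors `u_υ`, fine ones `G′_ℓ` on `S′`, `u′_υ`; a pairing `pt : S′ → S` with uniform fibres of `m` points and `m·w′ = w`.  POSITIVE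
WEIGHTS `θ_ℓ`, `ϑ_υ` on the coarse lattice (the small parts: `exp[−δ|x − y|]`, `exp[−δ|x − y_υ|]`), and STRIPPED majorants: sizes `‖G_ℓ(x, y)‖ ≤ P_ℓ(x, y)θ_ℓ(x, y)`,
`‖G′_ℓ(x′, y′)‖ ≤ P_ℓ(x, y)θ_ℓ(x, y)` and rates `‖G′_ℓ(x′, y′) − G_ℓ(x, y)‖ ≤ Q_ℓ(x, y)θ_ℓ(x, y)` with `x = pt x′`, `y = pt y′` (Prop. 3.7 «Furthermore …», Prop. 3.9
(3.73) — both read at the paired coarse points), the same for the one-vertex factors with `p_υ`, `q_υ`, `ϑ_υ`; all majorants nonnegative.  IF the weights'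
product is at most `Θ₀` at every coarse placement, `Π_ℓ θ_ℓ(σ(src ℓ), σ(tgt ℓ))·Π_υ ϑ_υ(σ(vtx υ)) ≤ Θ₀`, THEN
`‖E′ − E‖ ≤ Θ₀·(Σ_ℓ 𝔼(P[ℓ ↦ Q_ℓ]; p) + Σ_υ 𝔼(P; p[υ ↦ q_υ]))` — part Η-a's `norm_graphValLS_sub_le` VERBATIM on the stripped majorants, times `Θ₀`.
PROOF = DOUBLING: `E = graphValLS` of the graph with lines `Λ ⊕ Λ` (kernels `θ_ℓ⁻¹G_ℓ` and `θ_ℓ`) and factors `Υ ⊕ Υ` (`ϑ_υ⁻¹u_υ` and `ϑ_υ`), the same for `E′`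
with the weights read through `pt` — so the weight lines have two-spacing rate `0`; part Η-a's engine on the doubled graph; the terms with a weight replaced by
its rate `0` vanish (§1), the others are weight-doubled majorant graphs, extracted by §1.
[cite: King1986, p.664 («By extracting a small part of each propagator, we get the exponential decay on the right-hand side of (3.56)»), pp.664–665 (the
replacement step), Prop. 3.9 (3.73) p.665] -/
theorem norm_graphValLS_sub_le_of_weight (pt : S' → S) {m : ℕ} (hfib : ∀ x : S, (univ.filter fun x' : S' => pt x' = x).card = m)
    {w w' : 𝕜} (hw : (m : 𝕜) * w' = w) (src tgt : Λ → V) (vtx : Υ → V)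
    (G : Λ → S → S → 𝕜) (G' : Λ → S' → S' → 𝕜) (θ P Q : Λ → S → S → ℝ)
    (hθ : ∀ ℓ x y, 0 < θ ℓ x y) (hP0 : ∀ ℓ x y, 0 ≤ P ℓ x y) (hQ0 : ∀ ℓ x y, 0 ≤ Q ℓ x y)
    (hP : ∀ ℓ x y, ‖G ℓ x y‖ ≤ P ℓ x y * θ ℓ x y) (hP' : ∀ ℓ x' y', ‖G' ℓ x' y'‖ ≤ P ℓ (pt x') (pt y') * θ ℓ (pt x') (pt y'))
    (hQ : ∀ ℓ x' y', ‖G' ℓ x' y' - G ℓ (pt x') (pt y')‖ ≤ Q ℓ (pt x') (pt y') * θ ℓ (pt x') (pt y'))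
    (u : Υ → S → 𝕜) (u' : Υ → S' → 𝕜) (ϑ p q : Υ → S → ℝ)
    (hϑ : ∀ υ x, 0 < ϑ υ x) (hp0 : ∀ υ x, 0 ≤ p υ x) (hq0 : ∀ υ x, 0 ≤ q υ x)
    (hp : ∀ υ x, ‖u υ x‖ ≤ p υ x * ϑ υ x) (hp' : ∀ υ x', ‖u' υ x'‖ ≤ p υ (pt x') * ϑ υ (pt x'))
    (hq : ∀ υ x', ‖u' υ x' - u υ (pt x')‖ ≤ q υ (pt x') * ϑ υ (pt x')) {Θ₀ : ℝ}
    (hΘ : ∀ σ : V → S, (∏ ℓ, θ ℓ (σ (src ℓ)) (σ (tgt ℓ))) * ∏ υ, ϑ υ (σ (vtx υ)) ≤ Θ₀) :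
    ‖graphValLS w' src tgt G' vtx u' - graphValLS w src tgt G vtx u‖
      ≤ Θ₀ * (∑ ℓ, graphValLS ‖w‖ src tgt (Function.update P ℓ (Q ℓ)) vtx p
              + ∑ υ, graphValLS ‖w‖ src tgt P vtx (Function.update p υ (q υ))) := by
  classical
  -- the stripped kernels and the weights as kernels
  set Gs : Λ → S → S → 𝕜 := fun ℓ x y => ((θ ℓ x y : 𝕜))⁻¹ * G ℓ x y with hGs
  set Gs' : Λ → S' → S' → 𝕜 := fun ℓ x' y' => ((θ ℓ (pt x') (pt y') : 𝕜))⁻¹ * G' ℓ x' y' with hGs'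
  set Θk : Λ → S → S → 𝕜 := fun ℓ x y => (θ ℓ x y : 𝕜) with hΘk
  set Θk' : Λ → S' → S' → 𝕜 := fun ℓ x' y' => (θ ℓ (pt x') (pt y') : 𝕜) with hΘk'
  set us : Υ → S → 𝕜 := fun υ x => ((ϑ υ x : 𝕜))⁻¹ * u υ x with hus
  set us' : Υ → S' → 𝕜 := fun υ x' => ((ϑ υ (pt x') : 𝕜))⁻¹ * u' υ x' with hus'
  set ϑk : Υ → S → 𝕜 := fun υ x => (ϑ υ x : 𝕜) with hϑk
  set ϑk' : Υ → S' → 𝕜 := fun υ x' => (ϑ υ (pt x') : 𝕜) with hϑk'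
  -- un-stripping on both lattices: the doubled graphs ARE the given ones
  have hE : graphValLS w src tgt G vtx u
      = graphValLS w (Sum.elim src src) (Sum.elim tgt tgt) (Sum.elim Gs Θk) (Sum.elim vtx vtx) (Sum.elim us ϑk) := by
    rw [graphValLS_sumElim]
    unfold graphValLS
    refine sum_congr rfl fun σ _ => ?_
    rw [← prod_mul_distrib, ← prod_mul_distrib]
    congr 1; congr 1
    · exact prod_congr rfl fun ℓ _ => (ofReal_mul_inv_mul (hθ ℓ _ _).ne').symm
    · exact prod_congr rfl fun υ _ => (ofReal_mul_inv_mul (hϑ υ _).ne').symm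
  have hE' : graphValLS w' src tgt G' vtx u'
      = graphValLS w' (Sum.elim src src) (Sum.elim tgt tgt) (Sum.elim Gs' Θk') (Sum.elim vtx vtx) (Sum.elim us' ϑk') := by
    rw [graphValLS_sumElim]
    unfold graphValLS
    refine sum_congr rfl fun σ' _ => ?_
    rw [← prod_mul_distrib, ← prod_mul_distrib]
    congr 1; congr 1
    · exact prod_congr rfl fun ℓ _ => (ofReal_mul_inv_mul (hθ ℓ _ _).ne').symm
    · exact prod_congr rfl fun υ _ => (ofReal_mul_inv_mul (hϑ υ _).ne').symm
  -- part Η-a's engine on the doubled graph: the weight lines ∕ factors have rate ZERO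
  set Z : Λ → S → S → ℝ := fun _ _ _ => 0 with hZ
  set z : Υ → S → ℝ := fun _ _ => 0 with hz
  have hEng := norm_graphValLS_sub_le (𝕜 := 𝕜) pt hfib hw (Sum.elim src src) (Sum.elim tgt tgt) (Sum.elim vtx vtx)
    (Sum.elim Gs Θk) (Sum.elim Gs' Θk') (Sum.elim P θ) (Sum.elim Q Z)
    (by
      rintro (ℓ | ℓ) x y
      · simp only [Sum.elim_inl, hGs]; exact norm_inv_ofReal_mul_le (hθ ℓ x y) (hP ℓ x y)
      · simp only [Sum.elim_inr, hΘk, RCLike.norm_ofReal, abs_of_pos (hθ ℓ x y)]; exact le_rfl)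
    (by
      rintro (ℓ | ℓ) x' y'
      · simp only [Sum.elim_inl, hGs']; exact norm_inv_ofReal_mul_le (hθ ℓ _ _) (hP' ℓ x' y')
      · simp only [Sum.elim_inr, hΘk', RCLike.norm_ofReal, abs_of_pos (hθ ℓ _ _)]; exact le_rfl)
    (by
      rintro (ℓ | ℓ) x' y'
      · simp only [Sum.elim_inl, hGs, hGs', ← mul_sub]; exact norm_inv_ofReal_mul_le (hθ ℓ _ _) (hQ ℓ x' y')
      · simp only [Sum.elim_inr, hΘk, hΘk', sub_self, norm_zero, hZ]; exact le_rfl)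
    (Sum.elim us ϑk) (Sum.elim us' ϑk') (Sum.elim p ϑ) (Sum.elim q z)
    (by
      rintro (υ | υ) x
      · simp only [Sum.elim_inl, hus]; exact norm_inv_ofReal_mul_le (hϑ υ x) (hp υ x)
      · simp only [Sum.elim_inr, hϑk, RCLike.norm_ofReal, abs_of_pos (hϑ υ x)]; exact le_rfl)
    (by
      rintro (υ | υ) x'
      · simp only [Sum.elim_inl, hus']; exact norm_inv_ofReal_mul_le (hϑ υ _) (hp' υ x')
      · simp only [Sum.elim_inr, hϑk', RCLike.norm_ofReal, abs_of_pos (hϑ υ _)]; exact le_rfl)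
    (by
      rintro (υ | υ) x'
      · simp only [Sum.elim_inl, hus, hus', ← mul_sub]; exact norm_inv_ofReal_mul_le (hϑ υ _) (hq υ x')
      · simp only [Sum.elim_inr, hϑk, hϑk', sub_self, norm_zero, hz]; exact le_rfl)
  rw [hE, hE']
  refine hEng.trans ?_
  -- split the doubled sums; the weight terms vanish, the others extract `Θ₀`
  have hω : 0 ≤ ‖w‖ := norm_nonneg _
  rw [Fintype.sum_sum_type, Fintype.sum_sum_type, mul_add, mul_sum, mul_sum]
  have hA : ∀ ℓ : Λ, graphValLS ‖w‖ (Sum.elim src src) (Sum.elim tgt tgt)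
        (Function.update (Sum.elim P θ) (Sum.inl ℓ) (Sum.elim Q Z (Sum.inl ℓ))) (Sum.elim vtx vtx) (Sum.elim p ϑ)
      ≤ Θ₀ * graphValLS ‖w‖ src tgt (Function.update P ℓ (Q ℓ)) vtx p := fun ℓ => by
    rw [Sum.elim_inl, Sum.update_elim_inl]
    refine graphValLS_sumElim_le_of_weight hω src tgt vtx _ θ p ϑ (fun ℓ' a b => ?_) hp0 hΘ
    by_cases h : ℓ' = ℓ
    · subst h; rw [Function.update_self]; exact hQ0 _ _ _
    · rw [Function.update_of_ne h]; exact hP0 _ _ _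
  have hB : ∀ ℓ : Λ, graphValLS ‖w‖ (Sum.elim src src) (Sum.elim tgt tgt)
        (Function.update (Sum.elim P θ) (Sum.inr ℓ) (Sum.elim Q Z (Sum.inr ℓ))) (Sum.elim vtx vtx) (Sum.elim p ϑ) = 0 :=
    fun ℓ => graphValLS_eq_zero_of_line _ _ _ _ _ _ (Sum.inr ℓ) fun x y => by
      rw [Function.update_self, Sum.elim_inr]
  have hC : ∀ υ : Υ, graphValLS ‖w‖ (Sum.elim src src) (Sum.elim tgt tgt) (Sum.elim P θ) (Sum.elim vtx vtx)
        (Function.update (Sum.elim p ϑ) (Sum.inl υ) (Sum.elim q z (Sum.inl υ)))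
      ≤ Θ₀ * graphValLS ‖w‖ src tgt P vtx (Function.update p υ (q υ)) := fun υ => by
    rw [Sum.elim_inl, Sum.update_elim_inl]
    refine graphValLS_sumElim_le_of_weight hω src tgt vtx P θ _ ϑ hP0 (fun υ' a => ?_) hΘ
    by_cases h : υ' = υ
    · subst h; rw [Function.update_self]; exact hq0 _ _
    · rw [Function.update_of_ne h]; exact hp0 _ _
  have hD : ∀ υ : Υ, graphValLS ‖w‖ (Sum.elim src src) (Sum.elim tgt tgt) (Sum.elim P θ) (Sum.elim vtx vtx)
        (Function.update (Sum.elim p ϑ) (Sum.inr υ) (Sum.elim q z (Sum.inr υ))) = 0 :=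
    fun υ => graphValLS_eq_zero_of_factor _ _ _ _ _ _ (Sum.inr υ) fun x => by
      rw [Function.update_self, Sum.elim_inr]
  simp only [hB, hD, sum_const_zero, add_zero]
  exact add_le_add (sum_le_sum fun ℓ _ => hA ℓ) (sum_le_sum fun υ _ => hC υ)

end Engine

end Summit.QuantumFields.YangMills.BalabanUVNodes.N15KingModelRung.Graph

end
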